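/-
Copyright (c) 2026 the pub-hodgecm-mathlib formalisation cell (harness21).  Prover seat hodgecm-mathlib-K2E1-p13 (g4), Track B ∕ K2-LIT, h413 = `stmt-HodgeConjecture-24833`,
R90-TF section S8 «ContSpec-n½», #2 chain (G side), deal S8-R72∕R79∕R118 of R90-CS-plan (g2), (XF)₃ sub-cut C4b = the HEAD (census `R90/S8/CENSUS-XF3.K2E1-p13-g4.md`): the CROSS-FAMILY
VANISHING `⟨θ_{f,φ}, θ_{f′,φ′}⟩_X = 0` for non-associate Borel pair data on `U(2,1)_{L∕L⁺}` and the DISCHARGE of the visible letter `hXF` of ★ R6₃ «of letters» (p862757).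
-/
import Summits.HodgeConjecture.HodgeConjecture.Theorems.K2E1ChiPseudoEisensteinWeightBracketsCMThree       -- ★ C4a (this seat): ENGINE + the two weighted brackets; brings ★ C3, ★ C3′, ★ C1, ★ GR-χ
import Summits.HodgeConjecture.HodgeConjecture.Theorems.K2E1ChiPseudoEisensteinRadialCMThree               -- ★ C2 p862856 (this seat): `θ_{f,ψ}` on `U(2,1)`: Borel, bounded, constant term; brings ★ D0 §3 every-rank unfolding
import Summits.HodgeConjecture.HodgeConjecture.Theorems.K2E1ChiPseudoEisensteinFamiliesOrthogonalCMThree   -- ★ R6₃ «of letters» p862757 (this seat): `hBO_of_pairXF`, `chiSectionSpacePair`, `resGBlock`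
import Summits.HodgeConjecture.HodgeConjecture.Theorems.K2E1ChiPseudoEisensteinFamiliesOrthogonalRayTrivialCMTwo -- ★ (K2E1-p16): `not_isNormTwist_mul_inv_of_rayTrivial_of_ne`, `…_reflectChar_…'`; brings ★ `norm_borelConstantTerm_le`
import Summits.HodgeConjecture.HodgeConjecture.Theorems.K2E1BorelWeightAverage                              -- ★ AVG₃ `integral_wt_smul_mul_conj_eq_mul_conj_borelConstantTerm_three`
import Summits.HodgeConjecture.HodgeConjecture.Theorems.K2E1HeisenbergHaarU3                                 -- ★ `isInvInvariant_of_isHaarMeasure_adelicUnipotent_three`, `locallyCompactSpace_and_secondCountableTopology_adelicUnipotent`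
import Literature.NumberTheory.Automorphic.UnitaryGroupBorelConstantTermInvariance                           -- ★ `borelConstantTerm_rational_borel_mul_of_rational_invariant`
import HarnessLib

/-!
# (XF)₃ C4b — `K2E1ChiPseudoEisensteinInnerProductCMThree`: NON-ASSOCIATE FAMILIES OF TWISTED PSEUDO-EISENSTEIN SERIES ON `U(2,1)_{L∕L⁺}` ARE ORTHOGONAL; THE LETTER `hXF` OF ★ R6₃ DISCHARGED

Track B ∕ K2-LIT, crux h413 = `stmt-HodgeConjecture-24833`, route of record `HCCMUnconditional`; cell `hodgecm-mathlib`, R90-TF programme, section S8 «ContSpec-n½», #2 chain, CLOSURE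
TARGET R90_CLOSURE_DAG row T2.1 (xref E2.G8.R1 (δ)).  THEOREMS ONLY (no `def`, no `instance`, no `notation`, no named-fact hypothesis, no `sorry`; default heartbeats); lane
`--supports stmt-HodgeConjecture-24833 --as helper` (count-neutral).

THE MATHEMATICS ([MoeglinWaldspurger1995] II.2.1; [Rogawski1990] §7.3 pp. 96–98, §13.9 p. 229; [TateThesis1967] Thm. 4.4.1).  Borel pair data `(χ₁, χ₂)` on `U(J₃)` over the CM pair
`(L⁺, L, conj)`: `χ₁` a unitary Hecke character of `L` (read on `d₀ = b₀₀`), `χ₂` an automorphic character of `U(1)(𝔸_{L⁺})` (read on `b₁₁`); `θ_{f,φ} = E((f∘H)·φ)` for `f ∈ C_c((0,∞))`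
and a continuous bounded `(χ₁,χ₂)`-pair-section `φ`.  UNFOLD (★ every-rank `exists_integral_quotFun_eisensteinSeriesU_mul_conj_eq`): `∫_X θ_{f,φ}·conj θ_{f′,φ′} dμ =
c_μ·∫_{G(𝔸)} β•((f∘H)φ·conj θ′)`; replace `θ′` by its constant term (★ AVG₃) `θ′_B = (f′∘H)φ′ + J`, `J = (ν𝓕)⁻¹•∫_{N(𝔸)}(f′∘H)(w₀v·)φ′(w₀v·)dν` (★ C2); the bracket splits as
`[Ψ₁]_β + [Ψ₂]_β` and BOTH vanish by ★ C4a (dichotomy: `χ₂ ≠ χ₂′` ⇒ the `U(1)`-fibre kills them, ★ C3′; `χ₂ = χ₂′` ⇒ ★ (δ)₃ push + ★ GR-χ Lemma B unless `χ₁χ₁′⁻¹`, resp. `χ₁(χ₁′ʷ)⁻¹`, is a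
norm twist).  For RAY-TRIVIAL `χ₁, χ₁′` the norm-twist letters follow from plain `χ₁′ ≠ χ₁`, `χ₁′ ≠ χ₁ʷ` (★ `eq_of_isNormTwist_mul_inv_of_rayTrivial`, ★ `reflectChar_reflectChar`).
* §1 **`chiPseudoEisenstein_inner_product_eq_zero_cm_three`** — (XF)₃ for ONE pair of pair data (integrable, `∫_X θ·conj θ′ dμ = 0`) whenever `χ₂ ≠ χ₂′` OR neither `χ₁χ₁′⁻¹` nor
  `χ₁(χ₁′ʷ)⁻¹` is a norm twist; CONTINUOUS profiles (no Mellin transform, no `C²`, no density step); `inner_toLp_chiPseudoEisenstein_eq_zero_cm_three` — the `L²(X, μ)` form.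
* §2 HEAD **`hXF_of_rayTrivial_cm_three`** — THE VISIBLE LETTER `hXF` OF ★ p862757 `hBO_of_pairXF` (its BYTES, ∀-closed over an index type `ι`) for families `b ↦ (χ₁ b, χ₂ b)` of unitary
  RAY-TRIVIAL Hecke characters and automorphic `U(1)`-characters whose continuous pair sections at `(K′, ω)` are bounded (letters `hχb`, as at N = 2 ★ RayTrivialCMTwo), given the
  structural Haar ∕ fundamental-domain data; **`hBO_of_rayTrivial_cm_three`** = ★ `hBO_of_pairXF` WITH `hXF` DISCHARGED (`resGBlock b ⟂ resGBlock b′` for non-associate `b ≠ b′`).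
HONEST LABEL: HC_CM is proved only modulo the 7 printed citations (2 remaining named inputs: hLiu418 = `stmt-HodgeConjecture-24832`, h413 = `stmt-HodgeConjecture-24833`) until rung 0
closes; REL ≠ ★ ≠ BUILT; this file asserts no named fact and closes no socket ((XF)₃ pays ★ R6₃'s `hXF` ⇒ (O₃)'s `hBO`, whose other letters stand); count-neutral.

## References
* [MoeglinWaldspurger1995] C. Mœglin, J.-L. Waldspurger, *Spectral Decomposition and Eisenstein Series* (1995), II.1.7, II.2.1, IV.2.
* [Rogawski1990] J. D. Rogawski, *Automorphic Representations of Unitary Groups in Three Variables* (1990), §7.3 pp. 96–98, §13.9 p. 229.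
* [TateThesis1967] J. Tate, *Fourier analysis in number fields and Hecke's zeta-functions*, in Cassels–Fröhlich (1967), §4.3, Thm. 4.4.1.
-/

set_option autoImplicit false
set_option linter.dupNamespace false  -- the mandated namespace repeats the summit's segment (`HodgeConjecture.HodgeConjecture`)

noncomputable section

open MeasureTheory Measure Set Filter Topology Complex NumberField IsDedekindDomain MulAction
open scoped Real NNReal ENNReal ComplexConjugate InnerProductSpace
open Literature.MeasureTheory.Group Literature.NumberTheory
open Literature.NumberTheory.Automorphic Literature.NumberTheory.Automorphic.UnitaryGroup AdelicGroupData
open Literature.NumberTheory.GaloisRepresentations (HeckeCharacter ideleGroup)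
open Literature.NumberTheory.Automorphic.Arthur2013.Leaves.TECR
open Summit.HodgeConjecture.HodgeConjecture.Cruxes.H413.K2E1BorelEisensteinU
open Summit.HodgeConjecture.HodgeConjecture.Cruxes.H413.K2E1CharacterEisensteinU2Defs
open Summit.HodgeConjecture.HodgeConjecture.Cruxes.H413.K2E1CharacterEisensteinU3PairDefs
open Summit.HodgeConjecture.HodgeConjecture.Cruxes.H413.K2E1ChiSectionSpaceU3PairDefs
open Summit.HodgeConjecture.HodgeConjecture.Cruxes.H413.K2E1PseudoEisensteinRadialCMTwo (exists_integral_quotFun_eisensteinSeriesU_mul_conj_eq lintegral_weight_mul_conj_lt_top)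
open Summit.HodgeConjecture.HodgeConjecture.Cruxes.H413.K2E1ChiPseudoEisensteinRadialCMTwo (comp_borelHeight_mul_arithmeticBorel_mul comp_borelHeight_mul_unipotent_mul eisensteinSeriesU_comp_borelHeight_mul_arithmeticSubgroup_mul)
open Summit.HodgeConjecture.HodgeConjecture.Cruxes.H413.K2E1ChiPseudoEisensteinRadialCMThree (measurable_eisensteinSeriesU_comp_borelHeight_mul_cm_three exists_bound_eisensteinSeriesU_comp_borelHeight_mul_cm_three borelConstantTerm_eisensteinSeriesU_comp_borelHeight_mul_cm_three)
open Summit.HodgeConjecture.HodgeConjecture.Cruxes.H413.K2E1ChiSectionTorusAverageU3 (borelHeight_torus_mul_maximalCompact_three)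
open Summit.HodgeConjecture.HodgeConjecture.Cruxes.H413.K2E1ChiPseudoEisensteinIdeleSplitCMThree (setLIntegral_normSq_inv_mul_enorm_comp_lt_top)
open Summit.HodgeConjecture.HodgeConjecture.Cruxes.H413.K2E1ChiPseudoEisensteinWeightBracketsCMThree (integral_weight_smul_wOne_eq_zero_cm_three integral_weight_smul_wZero_eq_zero_cm_three)
open Summit.HodgeConjecture.HodgeConjecture.Cruxes.H413.K2E1EisensteinPairingUnfoldedWeight (exists_integral_weight_smul_eq_mul_setIntegral_ideleClass_three)
open Summit.HodgeConjecture.HodgeConjecture.Cruxes.H413.K2E1BorelWeightAverage (integral_wt_smul_mul_conj_eq_mul_conj_borelConstantTerm_three)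
open Summit.HodgeConjecture.HodgeConjecture.Cruxes.H413.K2E1TruncatedEisensteinBoundedCMThree (measurable_borelConstantTerm)
open Summit.HodgeConjecture.HodgeConjecture.Cruxes.H413.K2E1ChiPseudoEisensteinIdeleLevelCMTwo (norm_borelConstantTerm_le)
open Summit.HodgeConjecture.HodgeConjecture.Cruxes.H413.K2E1ChiPseudoEisensteinFamiliesOrthogonalRayTrivialCMTwo (not_isNormTwist_mul_inv_of_rayTrivial_of_ne not_isNormTwist_mul_inv_reflectChar_of_rayTrivial_of_ne')
open Summit.HodgeConjecture.HodgeConjecture.Cruxes.H413.K2E1ChiPseudoEisensteinFamiliesOrthogonalCMThree (hBO_of_pairXF)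
open Summit.HodgeConjecture.HodgeConjecture.Cruxes.H413.K2E1HeisenbergHaarU3 (isInvInvariant_of_isHaarMeasure_adelicUnipotent_three locallyCompactSpace_and_secondCountableTopology_adelicUnipotent)
open Summit.HodgeConjecture.HodgeConjecture.R90.S8 (resGBlock)

namespace Summit.HodgeConjecture.HodgeConjecture.Cruxes.H413.K2E1ChiPseudoEisensteinInnerProductCMThree

variable (L : Type) [Field L] [NumberField L] [IsCMField L]
variable [MeasurableSpace (quasiSplit (↥(maximalRealSubfield L)) L (IsCMField.complexConj L) 3).Adelic] [BorelSpace (quasiSplit (↥(maximalRealSubfield L)) L (IsCMField.complexConj L) 3).Adelic]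
variable [MeasurableSpace (AdeleRing (𝓞 L) L)ˣ] [BorelSpace (AdeleRing (𝓞 L) L)ˣ]

/-! ## §1 (XF)₃ for one pair of pair data -/

/-- **(XF)₃ — NON-ASSOCIATE PAIR DATA GIVE ORTHOGONAL TWISTED PSEUDO-EISENSTEIN SERIES ON `U(2,1)_{L∕L⁺}`.**  Structural data: an automorphic `μ` on `X`, an inversion-invariant Haar `ν_G`,
Haar `μ_K` on `K_U`, `ν_I` on `𝕀_L` with an idele class domain `𝓕_I`, `ν` on `N(𝔸)` with a fundamental domain `𝓕` of `N(L⁺)` of compact closure.  For Hecke characters `χ₁, χ₁′` (`χ₁′` UNITARY; no hypothesis on `χ₁`),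
AUTOMORPHIC `U(1)`-characters `χ₂, χ₂′` such that `χ₂ ≠ χ₂′` OR (neither `χ₁χ₁′⁻¹` nor `χ₁(χ₁′ʷ)⁻¹` is a norm twist), continuous bounded pair sections `φ ∈ (χ₁,χ₂)`, `φ′ ∈ (χ₁′,χ₂′)` and
continuous `f, f′ ∈ C_c((0,∞))`: the pairing of `θ_{f,φ}` and `θ_{f′,φ′}` over `X` is `μ`-integrable and **`∫_X θ_{f,φ}·conj θ_{f′,φ′} dμ = 0`** (unfolding ★, AVG₃ ★, constant term ★ C2,
brackets ★ C4a). [cite: MoeglinWaldspurger1995, II.2.1] [cite: Rogawski1990, §7.3 (pp. 96–98)] [cite: TateThesis1967, Thm. 4.4.1] -/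
theorem chiPseudoEisenstein_inner_product_eq_zero_cm_three
    (μ : Measure (quasiSplit (↥(maximalRealSubfield L)) L (IsCMField.complexConj L) 3).automorphicQuotient) [(quasiSplit (↥(maximalRealSubfield L)) L (IsCMField.complexConj L) 3).IsAutomorphicMeasure μ]
    (νG : Measure (quasiSplit (↥(maximalRealSubfield L)) L (IsCMField.complexConj L) 3).Adelic) [νG.IsHaarMeasure] [νG.IsInvInvariant]
    (μK : Measure ((standardMaximalCompactGL 3 L).comap (adelicVal (↥(maximalRealSubfield L)) L (IsCMField.complexConj L) 3 ((StdForm.antidiagonal 3).over L)) : Subgroup (quasiSplit (↥(maximalRealSubfield L)) L (IsCMField.complexConj L) 3).Adelic)) [μK.IsHaarMeasure]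
    (νI : Measure (AdeleRing (𝓞 L) L)ˣ) [νI.IsHaarMeasure]
    {𝓕I : Set (AdeleRing (𝓞 L) L)ˣ} (h𝓕I : IsIdeleClassDomain L 𝓕I)
    (ν : Measure ↥(adelicUnipotent (↥(maximalRealSubfield L)) L (IsCMField.complexConj L) 3)) [ν.IsHaarMeasure] {𝓕 : Set ↥(adelicUnipotent (↥(maximalRealSubfield L)) L (IsCMField.complexConj L) 3)}
    (h𝓕N : IsFundamentalDomain ↥(rationalUnipotent (↥(maximalRealSubfield L)) L (IsCMField.complexConj L) 3) 𝓕 ν) (h𝓕c : IsCompact (closure 𝓕))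
    {χ₁ χ₁' : HeckeCharacter L} {χ₂ χ₂' : ↥(TorusDict.torus (IsCMField.complexConj L)) →ₜ* ℂˣ} {φ φ' : (quasiSplit (↥(maximalRealSubfield L)) L (IsCMField.complexConj L) 3).Adelic → ℂ}
    (hχ₁'u : χ₁'.IsUnitary) (hχ₂ : TorusDict.IsAutomorphic (IsCMField.complexConj L) χ₂) (hχ₂' : TorusDict.IsAutomorphic (IsCMField.complexConj L) χ₂')
    (hna : χ₂ ≠ χ₂' ∨ (¬ (χ₁ * χ₁'⁻¹).IsNormTwist ∧ ¬ (χ₁ * (reflectChar (IsCMField.complexConj L) χ₁')⁻¹).IsNormTwist))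
    (hφ : IsChiSectionPair χ₁ χ₂ φ) (hφc : Continuous φ) {Cφ : ℝ} (hφC : ∀ x, ‖φ x‖ ≤ Cφ)
    (hφ' : IsChiSectionPair χ₁' χ₂' φ') (hφ'c : Continuous φ') {Cφ' : ℝ} (hφ'C : ∀ x, ‖φ' x‖ ≤ Cφ')
    {f f' : ℝ → ℂ} (hf : Continuous f) (hfs : HasCompactSupport f) (hf0 : tsupport f ⊆ Ioi 0) (hf' : Continuous f') (hf's : HasCompactSupport f') (hf'0 : tsupport f' ⊆ Ioi 0) :
    Integrable (fun x : (quasiSplit (↥(maximalRealSubfield L)) L (IsCMField.complexConj L) 3).automorphicQuotient => (quasiSplit (↥(maximalRealSubfield L)) L (IsCMField.complexConj L) 3).quotFun (eisensteinSeriesU (fun g : (quasiSplit (↥(maximalRealSubfield L)) L (IsCMField.complexConj L) 3).Adelic => f (borelHeight g : ℝ) * φ g)) x * conj ((quasiSplit (↥(maximalRealSubfield L)) L (IsCMField.complexConj L) 3).quotFun (eisensteinSeriesU (fun g : (quasiSplit (↥(maximalRealSubfield L)) L (IsCMField.complexConj L) 3).Adelic => f' (borelHeight g : ℝ) * φ'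 g)) x)) μ ∧
    ∫ x, (quasiSplit (↥(maximalRealSubfield L)) L (IsCMField.complexConj L) 3).quotFun (eisensteinSeriesU (fun g : (quasiSplit (↥(maximalRealSubfield L)) L (IsCMField.complexConj L) 3).Adelic => f (borelHeight g : ℝ) * φ g)) x * conj ((quasiSplit (↥(maximalRealSubfield L)) L (IsCMField.complexConj L) 3).quotFun (eisensteinSeriesU (fun g : (quasiSplit (↥(maximalRealSubfield L)) L (IsCMField.complexConj L) 3).Adelic => f' (borelHeight g : ℝ) * φ' g)) x) ∂μ = 0 := by
  classical
  -- (0) structure, constants, the covering weight `β`, the three ★ packages (unfolding, AVG₃ needs none, (δ)₃ for the `L¹` letter)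
  haveI := t2Space_adeleRing_of_numberField L
  haveI := locallyCompactSpace_adeleRing' L
  haveI := secondCountableTopology_adeleRing L
  haveI : SecondCountableTopology (quasiSplit (↥(maximalRealSubfield L)) L (IsCMField.complexConj L) 3).Adelic := inferInstanceAs (SecondCountableTopology (adelic (↥(maximalRealSubfield L)) L (IsCMField.complexConj L) 3 ((StdForm.antidiagonal 3).over L)))
  have hc : IsCMField.complexConj L * IsCMField.complexConj L = 1 := AlgEquiv.ext fun x => IsCMField.complexConj_apply_apply L x
  have hc1 : IsCMField.complexConj L ≠ 1 := IsCMField.complexConj_ne_one L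
  have h2 := Algebra.IsQuadraticExtension.finrank_eq_two (↥(maximalRealSubfield L)) L
  haveI : ν.IsInvInvariant := isInvInvariant_of_isHaarMeasure_adelicUnipotent_three hc ν
  obtain ⟨hN1, hN2⟩ := locallyCompactSpace_and_secondCountableTopology_adelicUnipotent (F := ↥(maximalRealSubfield L)) (E := L) (c := IsCMField.complexConj L) (N := 3)
  haveI := hN1
  haveI := hN2
  haveI : SigmaFinite ν := inferInstance
  have h𝓕top : ν 𝓕 ≠ ∞ := ((measure_mono subset_closure).trans_lt h𝓕c.measure_lt_top).ne
  have h𝓕₀ : ν 𝓕 ≠ 0 := measure_ne_zero_of_isFundamentalDomain_rationalUnipotent ν h𝓕N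
  have hBK := exists_mem_borelAdelic_mul_mem_standardMaximalCompactGL_cm L (N := 3)
  have hKc : IsCompact ((((standardMaximalCompactGL 3 L).comap (adelicVal (↥(maximalRealSubfield L)) L (IsCMField.complexConj L) 3 ((StdForm.antidiagonal 3).over L)) : Subgroup (quasiSplit (↥(maximalRealSubfield L)) L (IsCMField.complexConj L) 3).Adelic)) : Set (quasiSplit (↥(maximalRealSubfield L)) L (IsCMField.complexConj L) 3).Adelic) := isCompact_comap_adelicVal_standardMaximalCompactGL
  haveI : CompactSpace ((standardMaximalCompactGL 3 L).comap (adelicVal (↥(maximalRealSubfield L)) L (IsCMField.complexConj L) 3 ((StdForm.antidiagonal 3).over L)) : Subgroup (quasiSplit (↥(maximalRealSubfield L)) L (IsCMField.complexConj L) 3).Adelic) := isCompact_iff_compactSpace.1 hKc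
  haveI : IsFiniteMeasure μK := CompactSpace.isFiniteMeasure
  haveI : DiscreteTopology (quasiSplit (↥(maximalRealSubfield L)) L (IsCMField.complexConj L) 3).arithmeticSubgroup := isDiscreteRational_quasiSplit
  haveI : DiscreteTopology ↥((arithmeticBorel (↥(maximalRealSubfield L)) L (IsCMField.complexConj L) 3).map (quasiSplit (↥(maximalRealSubfield L)) L (IsCMField.complexConj L) 3).arithmeticSubgroup.subtype) :=
    DiscreteTopology.of_subset ‹DiscreteTopology (quasiSplit (↥(maximalRealSubfield L)) L (IsCMField.complexConj L) 3).arithmeticSubgroup› (Subgroup.map_subtype_le _)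
  obtain ⟨β, hβ⟩ := exists_isCoveringWeight ((arithmeticBorel (↥(maximalRealSubfield L)) L (IsCMField.complexConj L) 3).map (quasiSplit (↥(maximalRealSubfield L)) L (IsCMField.complexConj L) 3).arithmeticSubgroup.subtype)
  obtain ⟨cμ, -, hunf⟩ := exists_integral_quotFun_eisensteinSeriesU_mul_conj_eq (F := ↥(maximalRealSubfield L)) (E := L) (c := IsCMField.complexConj L) (N := 3) μ νG
  obtain ⟨K, -, hKt, hδ0, -⟩ := exists_integral_weight_smul_eq_mul_setIntegral_ideleClass_three h2 hc hc1 νG μK νI hBK h𝓕I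
  have hIc : Continuous fun x : (AdeleRing (𝓞 L) L)ˣ => (IdeleClassGroup.ideleNorm L x : ℝ) := NNReal.continuous_coe.comp (continuous_ideleNorm_holds L)
  have hHc : Continuous fun g : (quasiSplit (↥(maximalRealSubfield L)) L (IsCMField.complexConj L) 3).Adelic => (borelHeight g : ℝ) := NNReal.continuous_coe.comp continuous_borelHeight
  -- names: `θ′`, `CT = θ′_B`, `J = θ′_B − (f′∘H)φ′`
  set θ' : (quasiSplit (↥(maximalRealSubfield L)) L (IsCMField.complexConj L) 3).Adelic → ℂ := eisensteinSeriesU (fun g : (quasiSplit (↥(maximalRealSubfield L)) L (IsCMField.complexConj L) 3).Adelic => f' (borelHeight g : ℝ) * φ' g) with hθ'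
  set CT : (quasiSplit (↥(maximalRealSubfield L)) L (IsCMField.complexConj L) 3).Adelic → ℂ := borelConstantTerm ν 𝓕 θ' with hCTdef
  set J : (quasiSplit (↥(maximalRealSubfield L)) L (IsCMField.complexConj L) 3).Adelic → ℂ := fun g => CT g - f' (borelHeight g : ℝ) * φ' g with hJdef
  -- (1) `θ′`: Borel, `G(L⁺)`-invariant, bounded; `CT`: Borel, left-`N(𝔸)`∕`B(L⁺)`-invariant; the constant term formula (★ C2)
  obtain ⟨M₁, hM₁⟩ := exists_bound_eisensteinSeriesU_comp_borelHeight_mul_cm_three L hf' hf's hf'0 hφ'c hφ'C (hφ'.toAdelic_mul hχ₂')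
  have hθ'm : Measurable θ' := measurable_eisensteinSeriesU_comp_borelHeight_mul_cm_three L hf' hf's hf'0 hφ'c hφ'C
  have hθ'G : ∀ (γ : (quasiSplit (↥(maximalRealSubfield L)) L (IsCMField.complexConj L) 3).arithmeticSubgroup) (x : (quasiSplit (↥(maximalRealSubfield L)) L (IsCMField.complexConj L) 3).Adelic), θ' ((γ : (quasiSplit (↥(maximalRealSubfield L)) L (IsCMField.complexConj L) 3).Adelic) * x) = θ' x := eisensteinSeriesU_comp_borelHeight_mul_arithmeticSubgroup_mul f' (hφ'.toAdelic_mul hχ₂')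
  have hCTm : Measurable CT := measurable_borelConstantTerm ν 𝓕 hθ'm
  have hCTN : ∀ u : (quasiSplit (↥(maximalRealSubfield L)) L (IsCMField.complexConj L) 3).Adelic, u ∈ adelicUnipotent (↥(maximalRealSubfield L)) L (IsCMField.complexConj L) 3 → ∀ y, CT (u * y) = CT y := fun u hu y =>
    borelConstantTerm_unipotent_mul_three hc ν h𝓕N (fun u' hu' x => hθ'G ⟨(u' : (quasiSplit (↥(maximalRealSubfield L)) L (IsCMField.complexConj L) 3).Adelic), hu'⟩ x) ⟨u, hu⟩ y
  have hCTB : ∀ b ∈ arithmeticBorel (↥(maximalRealSubfield L)) L (IsCMField.complexConj L) 3, ∀ y : (quasiSplit (↥(maximalRealSubfield L)) L (IsCMField.complexConj L) 3).Adelic, CT ((b : (quasiSplit (↥(maximalRealSubfield L)) L (IsCMField.complexConj L) 3).Adelic) * y) = CT y := fun b hb y =>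
    borelConstantTerm_rational_borel_mul_of_rational_invariant ν h𝓕N hθ'G b hb y
  have hJ : ∀ g : (quasiSplit (↥(maximalRealSubfield L)) L (IsCMField.complexConj L) 3).Adelic, J g = ((ν 𝓕).toReal⁻¹ : ℝ) • ∫ v : ↥(adelicUnipotent (↥(maximalRealSubfield L)) L (IsCMField.complexConj L) 3), f' (borelHeight ((quasiSplit (↥(maximalRealSubfield L)) L (IsCMField.complexConj L) 3).toAdelic (weylLongU ((IsCMField.complexConj L : L ≃ₐ[↥(maximalRealSubfield L)] L) : L →+* L) (rfl : (StdForm.antidiagonal 3).over L = (StdForm.antidiagonal 3).over L)) * (v : (quasiSplit (↥(maximalRealSubfield L)) L (IsCMField.complexConj L) 3).Adelic) * g) : ℝ) * φ' ((quasiSplit (↥(maximalRealSubfield L)) L (IsCMField.complexConj L) 3).toAdelic (weylLongU ((IsCMField.complexConj L : L ≃ₐ[↥(maximalRealSubfield L)] L) : L →+* L) (rfl : (StdForm.antidiagonal 3).over L = (StdForm.antidiagonal 3).over L)) * (v : (quasiSplit (↥(maximalRealSubfield L)) L (IsCMField.complexConj L) 3).Adelic) * g) ∂ν := fun g => by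
    rw [hJdef, hCTdef, hθ']
    simp only
    rw [borelConstantTerm_eisensteinSeriesU_comp_borelHeight_mul_cm_three L ν h𝓕N h𝓕c hf' hf's hf'0 hφ'c hφ'C hφ'.unipotent_mul (hφ'.toAdelic_mul hχ₂') g, add_sub_cancel_left]
  have hφ'B := (K2E1BorelCosetsDictionary.forall_arithmeticBorel_iff (ψ := φ')).2 (hφ'.toAdelic_mul hχ₂')
  have hJm : Measurable J := hCTm.sub (((hf'.comp hHc).measurable).mul hφ'c.measurable)
  have hJN : ∀ (n : ↥(unipotentInBorel (↥(maximalRealSubfield L)) L (IsCMField.complexConj L) 3)) (y : (quasiSplit (↥(maximalRealSubfield L)) L (IsCMField.complexConj L) 3).Adelic), J (((n : borelAdelic (↥(maximalRealSubfield L)) L (IsCMField.complexConj L) 3) : (quasiSplit (↥(maximalRealSubfield L)) L (IsCMField.complexConj L) 3).Adelic) * y) = J y := fun n y => by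
    have hn := (mem_unipotentInBorel_iff _).1 n.2
    simp only [hJdef, borelHeight_unipotent_mul hn, hφ'.unipotent_mul ⟨_, hn⟩ y, hCTN _ hn y]
  have hJB : ∀ b ∈ arithmeticBorel (↥(maximalRealSubfield L)) L (IsCMField.complexConj L) 3, ∀ y : (quasiSplit (↥(maximalRealSubfield L)) L (IsCMField.complexConj L) 3).Adelic, J ((b : (quasiSplit (↥(maximalRealSubfield L)) L (IsCMField.complexConj L) 3).Adelic) * y) = J y := fun b hb y => by
    simp only [hJdef, K2E1TruncatedEisensteinExplicit.borelHeight_arithmeticBorel_mul hb, hφ'B b hb y, hCTB b hb y]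
  -- (2) the `L¹` letter `∫⁻ β‖(f∘H)φ‖ < ∞` (★ (δ)₃ `[0,∞]` + ★ C3 §4)
  have hfm : Measurable fun g : (quasiSplit (↥(maximalRealSubfield L)) L (IsCMField.complexConj L) 3).Adelic => f (borelHeight g : ℝ) := (hf.comp hHc).measurable
  have hψm : Measurable fun g : (quasiSplit (↥(maximalRealSubfield L)) L (IsCMField.complexConj L) 3).Adelic => f (borelHeight g : ℝ) * φ g := hfm.mul hφc.measurable
  have hHtk := borelHeight_torus_mul_maximalCompact_three (F := ↥(maximalRealSubfield L)) (E := L) (c := IsCMField.complexConj L)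
  have hL1r : ∫⁻ g, β g * ‖f (borelHeight g : ℝ)‖ₑ ∂νG < ∞ := by
    have hL := hδ0 β hβ (fun g => ‖f (borelHeight g : ℝ)‖ₑ) hfm.enorm
      (fun n y => by simp only [borelHeight_unipotent_mul ((mem_unipotentInBorel_iff _).1 n.2)])
      (fun b hb y => by simp only [K2E1TruncatedEisensteinExplicit.borelHeight_arithmeticBorel_mul hb])
      (fun x => ‖f (IdeleClassGroup.ideleNorm L x : ℝ)‖ₑ * μK Set.univ) ((hf.comp hIc).measurable.enorm.mul_const _)
      (fun k hk x => by simp only [map_mul, ideleNorm_principal hk, one_mul]) (fun t => by simp_rw [hHtk t]; exact lintegral_const _)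
    rw [hL]
    exact ENNReal.mul_lt_top hKt.lt_top (setLIntegral_normSq_inv_mul_enorm_comp_lt_top νI h𝓕I hf hfs hf0 (measure_ne_top μK _))
  have hL1 : ∫⁻ g, β g * ‖f (borelHeight g : ℝ) * φ g‖ₑ ∂νG < ∞ := by
    have hφe : ∀ g, ‖φ g‖ₑ ≤ ENNReal.ofReal Cφ := fun g => by rw [← ofReal_norm]; exact ENNReal.ofReal_le_ofReal (hφC g)
    calc ∫⁻ g, β g * ‖f (borelHeight g : ℝ) * φ g‖ₑ ∂νG ≤ ∫⁻ g, β g * ‖f (borelHeight g : ℝ)‖ₑ * ENNReal.ofReal Cφ ∂νG :=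
          lintegral_mono fun g => by rw [enorm_mul, ← mul_assoc]; gcongr; exact hφe g
      _ = (∫⁻ g, β g * ‖f (borelHeight g : ℝ)‖ₑ ∂νG) * ENNReal.ofReal Cφ := lintegral_mul_const' _ _ ENNReal.ofReal_ne_top
      _ < ∞ := ENNReal.mul_lt_top hL1r ENNReal.ofReal_lt_top
  -- (3) unfolding `X → B(F)`-weight level; the average is free; the split `[Ψ]_β = [Ψ₁]_β + [Ψ₂]_β`; both brackets vanish (★ C4a)
  obtain ⟨hInt, hEq⟩ := hunf hβ (f := fun g => f (borelHeight g : ℝ) * φ g) (Λ' := θ') hψm (comp_borelHeight_mul_arithmeticBorel_mul f (hφ.toAdelic_mul hχ₂)) hθ'm hθ'G hM₁ hL1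
  refine ⟨hInt, ?_⟩
  have hAVG := integral_wt_smul_mul_conj_eq_mul_conj_borelConstantTerm_three hc hc1 νG ν h𝓕N h𝓕₀ h𝓕top hβ (ψ := fun g => f (borelHeight g : ℝ) * φ g) (Λ' := θ') hψm hθ'm
    (comp_borelHeight_mul_unipotent_mul f hφ.unipotent_mul) (comp_borelHeight_mul_arithmeticBorel_mul f (hφ.toAdelic_mul hχ₂)) (fun b _ x => hθ'G b x) (lintegral_weight_mul_conj_lt_top νG β hM₁ hL1)
  have hsplit : ∀ g : (quasiSplit (↥(maximalRealSubfield L)) L (IsCMField.complexConj L) 3).Adelic, (β g).toReal • ((fun g : (quasiSplit (↥(maximalRealSubfield L)) L (IsCMField.complexConj L) 3).Adelic => f (borelHeight g : ℝ) * φ g) g * conj (borelConstantTerm ν 𝓕 θ' g)) =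
      (β g).toReal • (f (borelHeight g : ℝ) * φ g * conj (f' (borelHeight g : ℝ) * φ' g)) + (β g).toReal • (f (borelHeight g : ℝ) * φ g * conj (J g)) := fun g => by
    rw [← smul_add, hJdef]
    congr 1
    simp only [map_sub]
    change f (borelHeight g : ℝ) * φ g * conj (CT g) = _
    ring
  obtain ⟨hI₁, hE₁⟩ := integral_weight_smul_wOne_eq_zero_cm_three L νG μK νI h𝓕I hβ hχ₁'u hχ₂ hχ₂' (hna.imp_right And.left) hφ hφc hφC hφ' hφ'c hφ'C hf hfs hf0 hf' hf's
  obtain ⟨hI₂, hE₂⟩ := integral_weight_smul_wZero_eq_zero_cm_three L νG μK νI h𝓕I ν h𝓕N h𝓕c hβ hχ₁'u hχ₂ hχ₂' (hna.imp_right And.right) hφ hφc hφC hφ' hφ'c hφ'C hf hfs hf0 hf' hf's hf'0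
    ((ν 𝓕).toReal⁻¹) hJm hJN hJB hJ
  rw [hEq, hAVG, integral_congr_ae (ae_of_all _ hsplit), integral_add hI₁ hI₂, hE₁, hE₂, add_zero, mul_zero]

/-- **`⟪[θ_{f,φ}], [θ_{f′,φ′}]⟫_{L²(X,μ)} = 0`** under the hypotheses of §1, for ANY square-integrability witnesses `hv, hv′` (`⟪[θ],[θ′]⟫ = conj ∫ θ·conj θ′`, Mathlib `L2.inner_def`,
`MemLp.coeFn_toLp`, `integral_conj`). [cite: MoeglinWaldspurger1995, II.2.1] -/
theorem inner_toLp_chiPseudoEisenstein_eq_zero_cm_three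
    (μ : Measure (quasiSplit (↥(maximalRealSubfield L)) L (IsCMField.complexConj L) 3).automorphicQuotient) [(quasiSplit (↥(maximalRealSubfield L)) L (IsCMField.complexConj L) 3).IsAutomorphicMeasure μ]
    (νG : Measure (quasiSplit (↥(maximalRealSubfield L)) L (IsCMField.complexConj L) 3).Adelic) [νG.IsHaarMeasure] [νG.IsInvInvariant]
    (μK : Measure ((standardMaximalCompactGL 3 L).comap (adelicVal (↥(maximalRealSubfield L)) L (IsCMField.complexConj L) 3 ((StdForm.antidiagonal 3).over L)) : Subgroup (quasiSplit (↥(maximalRealSubfield L)) L (IsCMField.complexConj L) 3).Adelic)) [μK.IsHaarMeasure]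
    (νI : Measure (AdeleRing (𝓞 L) L)ˣ) [νI.IsHaarMeasure]
    {𝓕I : Set (AdeleRing (𝓞 L) L)ˣ} (h𝓕I : IsIdeleClassDomain L 𝓕I)
    (ν : Measure ↥(adelicUnipotent (↥(maximalRealSubfield L)) L (IsCMField.complexConj L) 3)) [ν.IsHaarMeasure] {𝓕 : Set ↥(adelicUnipotent (↥(maximalRealSubfield L)) L (IsCMField.complexConj L) 3)}
    (h𝓕N : IsFundamentalDomain ↥(rationalUnipotent (↥(maximalRealSubfield L)) L (IsCMField.complexConj L) 3) 𝓕 ν) (h𝓕c : IsCompact (closure 𝓕))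
    {χ₁ χ₁' : HeckeCharacter L} {χ₂ χ₂' : ↥(TorusDict.torus (IsCMField.complexConj L)) →ₜ* ℂˣ} {φ φ' : (quasiSplit (↥(maximalRealSubfield L)) L (IsCMField.complexConj L) 3).Adelic → ℂ}
    (hχ₁'u : χ₁'.IsUnitary) (hχ₂ : TorusDict.IsAutomorphic (IsCMField.complexConj L) χ₂) (hχ₂' : TorusDict.IsAutomorphic (IsCMField.complexConj L) χ₂')
    (hna : χ₂ ≠ χ₂' ∨ (¬ (χ₁ * χ₁'⁻¹).IsNormTwist ∧ ¬ (χ₁ * (reflectChar (IsCMField.complexConj L) χ₁')⁻¹).IsNormTwist))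
    (hφ : IsChiSectionPair χ₁ χ₂ φ) (hφc : Continuous φ) {Cφ : ℝ} (hφC : ∀ x, ‖φ x‖ ≤ Cφ)
    (hφ' : IsChiSectionPair χ₁' χ₂' φ') (hφ'c : Continuous φ') {Cφ' : ℝ} (hφ'C : ∀ x, ‖φ' x‖ ≤ Cφ')
    {f f' : ℝ → ℂ} (hf : Continuous f) (hfs : HasCompactSupport f) (hf0 : tsupport f ⊆ Ioi 0) (hf' : Continuous f') (hf's : HasCompactSupport f') (hf'0 : tsupport f' ⊆ Ioi 0)
    (hv : MemLp ((quasiSplit (↥(maximalRealSubfield L)) L (IsCMField.complexConj L) 3).quotFun (eisensteinSeriesU (fun g : (quasiSplit (↥(maximalRealSubfield L)) L (IsCMField.complexConj L) 3).Adelic => f (borelHeight g : ℝ) * φ g))) 2 μ) (hv' : MemLp ((quasiSplit (↥(maximalRealSubfield L)) L (IsCMField.complexConj L) 3).quotFun (eisensteinSeriesU (fun g : (quasiSplit (↥(maximalRealSubfield L)) L (IsCMField.complexConj L) 3).Adelic => f' (borelHeight g : ℝ) * φ' g))) 2 μ) :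
    ⟪hv.toLp _, hv'.toLp _⟫_ℂ = 0 := by
  obtain ⟨-, h0⟩ := chiPseudoEisenstein_inner_product_eq_zero_cm_three L μ νG μK νI h𝓕I ν h𝓕N h𝓕c hχ₁'u hχ₂ hχ₂' hna hφ hφc hφC hφ' hφ'c hφ'C hf hfs hf0 hf' hf's hf'0
  rw [L2.inner_def]
  have hae : (fun x => ⟪(hv.toLp _ : (quasiSplit (↥(maximalRealSubfield L)) L (IsCMField.complexConj L) 3).L2 μ) x, (hv'.toLp _ : (quasiSplit (↥(maximalRealSubfield L)) L (IsCMField.complexConj L) 3).L2 μ) x⟫_ℂ) =ᵐ[μ]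
      fun x => conj ((quasiSplit (↥(maximalRealSubfield L)) L (IsCMField.complexConj L) 3).quotFun (eisensteinSeriesU (fun g : (quasiSplit (↥(maximalRealSubfield L)) L (IsCMField.complexConj L) 3).Adelic => f (borelHeight g : ℝ) * φ g)) x * conj ((quasiSplit (↥(maximalRealSubfield L)) L (IsCMField.complexConj L) 3).quotFun (eisensteinSeriesU (fun g : (quasiSplit (↥(maximalRealSubfield L)) L (IsCMField.complexConj L) 3).Adelic => f' (borelHeight g : ℝ) * φ' g)) x)) := by
    filter_upwards [hv.coeFn_toLp, hv'.coeFn_toLp] with x hx hy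
    rw [hx, hy, map_mul, RCLike.conj_conj, RCLike.inner_apply, mul_comm]
  rw [integral_congr_ae hae, integral_conj, h0, map_zero]

/-! ## §2 HEAD: the visible letter `hXF` of ★ R6₃ «of letters» discharged for ray-trivial families -/

/-- **THE LETTER `hXF` OF ★ `hBO_of_pairXF` (p862757), DISCHARGED.**  Index type `ι`, a family of Borel pair data `b ↦ (χ₁ b, χ₂ b)` with `χ₁ b` UNITARY and RAY-TRIVIAL
(`χ₁ b (posRealIdele L r) = 1`) and `χ₂ b` AUTOMORPHIC, a level datum `(K′, ω)` whose continuous pair sections are bounded (letters `hχb`), and the structural Haar ∕ fundamental-domain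
data of §1.  THEN the bytes of `hXF`: for `b ≠ b′` with `(χ₁ b′, χ₂ b′)` neither `(χ₁ b, χ₂ b)` nor `((χ₁ b)ʷ, χ₂ b)`, every continuous-profile generator of the `b`-block is orthogonal to
every generator of the `b′`-block — §1 with the dichotomy hypothesis read off `¬PairAssoc`: either `χ₂ b ≠ χ₂ b′`, or `χ₂ b′ = χ₂ b` and then `χ₁ b′ ≠ χ₁ b`, `χ₁ b′ ≠ (χ₁ b)ʷ`, which for
ray-trivial characters kill both norm-twist alternatives (★ `not_isNormTwist_mul_inv_of_rayTrivial_of_ne`(′), ★ `reflectChar_reflectChar`). [cite: MoeglinWaldspurger1995, II.2.1]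
[cite: Rogawski1990, §13.9 p. 229] [cite: TateThesis1967, §4.3] -/
theorem hXF_of_rayTrivial_cm_three {ι : Type*}
    (μ : Measure (quasiSplit (↥(maximalRealSubfield L)) L (IsCMField.complexConj L) 3).automorphicQuotient) [(quasiSplit (↥(maximalRealSubfield L)) L (IsCMField.complexConj L) 3).IsAutomorphicMeasure μ]
    (νG : Measure (quasiSplit (↥(maximalRealSubfield L)) L (IsCMField.complexConj L) 3).Adelic) [νG.IsHaarMeasure] [νG.IsInvInvariant]
    (μK : Measure ((standardMaximalCompactGL 3 L).comap (adelicVal (↥(maximalRealSubfield L)) L (IsCMField.complexConj L) 3 ((StdForm.antidiagonal 3).over L)) : Subgroup (quasiSplit (↥(maximalRealSubfield L)) L (IsCMField.complexConj L) 3).Adelic)) [μK.IsHaarMeasure]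
    (νI : Measure (AdeleRing (𝓞 L) L)ˣ) [νI.IsHaarMeasure]
    {𝓕I : Set (AdeleRing (𝓞 L) L)ˣ} (h𝓕I : IsIdeleClassDomain L 𝓕I)
    (ν : Measure ↥(adelicUnipotent (↥(maximalRealSubfield L)) L (IsCMField.complexConj L) 3)) [ν.IsHaarMeasure] {𝓕 : Set ↥(adelicUnipotent (↥(maximalRealSubfield L)) L (IsCMField.complexConj L) 3)}
    (h𝓕N : IsFundamentalDomain ↥(rationalUnipotent (↥(maximalRealSubfield L)) L (IsCMField.complexConj L) 3) 𝓕 ν) (h𝓕c : IsCompact (closure 𝓕))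
    (K' : Subgroup (quasiSplit (↥(maximalRealSubfield L)) L (IsCMField.complexConj L) 3).Adelic) (ω : ↥K' →* ℂ)
    (χ₁ : ι → HeckeCharacter L) (χ₂ : ι → (↥(TorusDict.torus (IsCMField.complexConj L)) →ₜ* ℂˣ))
    (hu : ∀ b, (χ₁ b).IsUnitary) (hray : ∀ b (r : ℝ≥0ˣ), χ₁ b (posRealIdele L r) = 1) (hχ₂ : ∀ b, TorusDict.IsAutomorphic (IsCMField.complexConj L) (χ₂ b))
    (hχb : ∀ b (φ : (quasiSplit (↥(maximalRealSubfield L)) L (IsCMField.complexConj L) 3).Adelic → ℂ), φ ∈ chiSectionSpacePair (χ₁ b) (χ₂ b) K' (ω : ↥K' → ℂ) → Continuous φ → ∃ M : ℝ, ∀ g, ‖φ g‖ ≤ M) :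
    ∀ b b' : ι, b ≠ b' →
      ¬ ((χ₁ b' = χ₁ b ∧ χ₂ b' = χ₂ b) ∨ (χ₁ b' = reflectChar (IsCMField.complexConj L) (χ₁ b) ∧ χ₂ b' = χ₂ b)) →
      ∀ (f : ℝ → ℂ) (_ : Continuous f) (_ : HasCompactSupport f) (_ : tsupport f ⊆ Ioi 0)
        (φ : (quasiSplit (↥(maximalRealSubfield L)) L (IsCMField.complexConj L) 3).Adelic → ℂ) (_ : φ ∈ chiSectionSpacePair (χ₁ b) (χ₂ b) K' (ω : ↥K' → ℂ)) (_ : Continuous φ)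
        (hv : MemLp ((quasiSplit (↥(maximalRealSubfield L)) L (IsCMField.complexConj L) 3).quotFun (eisensteinSeriesU (fun g => f (borelHeight g) * φ g))) 2 μ)
        (f' : ℝ → ℂ) (_ : Continuous f') (_ : HasCompactSupport f') (_ : tsupport f' ⊆ Ioi 0)
        (φ' : (quasiSplit (↥(maximalRealSubfield L)) L (IsCMField.complexConj L) 3).Adelic → ℂ) (_ : φ' ∈ chiSectionSpacePair (χ₁ b') (χ₂ b') K' (ω : ↥K' → ℂ)) (_ : Continuous φ')
        (hv' : MemLp ((quasiSplit (↥(maximalRealSubfield L)) L (IsCMField.complexConj L) 3).quotFun (eisensteinSeriesU (fun g => f' (borelHeight g) * φ' g))) 2 μ),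
        ⟪hv.toLp _, hv'.toLp _⟫_ℂ = 0 := by
  have hc : IsCMField.complexConj L * IsCMField.complexConj L = 1 := AlgEquiv.ext fun x => IsCMField.complexConj_apply_apply L x
  intro b b' hne hna f hf hfs hf0 φ hφ hφc hv f' hf' hfs' hf0' φ' hφ' hφc' hv'
  obtain ⟨Cφ, hφC⟩ := hχb b φ hφ hφc
  obtain ⟨Cφ', hφC'⟩ := hχb b' φ' hφ' hφc'
  have hna' : χ₂ b ≠ χ₂ b' ∨ (¬ (χ₁ b * (χ₁ b')⁻¹).IsNormTwist ∧ ¬ (χ₁ b * (reflectChar (IsCMField.complexConj L) (χ₁ b'))⁻¹).IsNormTwist) := by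
    by_cases h2 : χ₂ b' = χ₂ b
    · refine Or.inr ⟨not_isNormTwist_mul_inv_of_rayTrivial_of_ne (hray b) (hray b') (fun h => hna (Or.inl ⟨h.symm, h2⟩)),
        not_isNormTwist_mul_inv_reflectChar_of_rayTrivial_of_ne' (hray b) (hray b') (fun h => hna (Or.inr ⟨?_, h2⟩))⟩
      rw [h, reflectChar_reflectChar hc]
    · exact Or.inl fun h => h2 h.symm
  exact inner_toLp_chiPseudoEisenstein_eq_zero_cm_three L μ νG μK νI h𝓕I ν h𝓕N h𝓕c (hu b') (hχ₂ b) (hχ₂ b') hna'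
    (isChiSectionPair_of_mem hφ) hφc hφC (isChiSectionPair_of_mem hφ') hφc' hφC' hf hfs hf0 hf' hfs' hf0' hv hv'

/-- **R6₃ WITH ITS LETTER PAID: NON-ASSOCIATE BOREL PAIR DATA HAVE ORTHOGONAL BLOCKS** — ★ `hBO_of_pairXF` (p862757) with `hXF := hXF_of_rayTrivial_cm_three …`: for `b ≠ b′` not
`PairAssoc`, `resGBlock (χ₁ b, χ₂ b) ⟂ resGBlock (χ₁ b′, χ₂ b′)` in `L²(X, μ)`.  CONSUMER: (O₃) `isOrtho_iSup_resGAtom_iSup_resGLine_of_letters … (Assoc := PairAssoc) (hBO := this)`.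
[cite: MoeglinWaldspurger1995, II.2.1] [cite: Rogawski1990, §13.9 p. 229] -/
theorem hBO_of_rayTrivial_cm_three {ι : Type*}
    (μ : Measure (quasiSplit (↥(maximalRealSubfield L)) L (IsCMField.complexConj L) 3).automorphicQuotient) [(quasiSplit (↥(maximalRealSubfield L)) L (IsCMField.complexConj L) 3).IsAutomorphicMeasure μ]
    (νG : Measure (quasiSplit (↥(maximalRealSubfield L)) L (IsCMField.complexConj L) 3).Adelic) [νG.IsHaarMeasure] [νG.IsInvInvariant]
    (μK : Measure ((standardMaximalCompactGL 3 L).comap (adelicVal (↥(maximalRealSubfield L)) L (IsCMField.complexConj L) 3 ((StdForm.antidiagonal 3).over L)) : Subgroup (quasiSplit (↥(maximalRealSubfield L)) L (IsCMField.complexConj L) 3).Adelic)) [μK.IsHaarMeasure]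
    (νI : Measure (AdeleRing (𝓞 L) L)ˣ) [νI.IsHaarMeasure]
    {𝓕I : Set (AdeleRing (𝓞 L) L)ˣ} (h𝓕I : IsIdeleClassDomain L 𝓕I)
    (ν : Measure ↥(adelicUnipotent (↥(maximalRealSubfield L)) L (IsCMField.complexConj L) 3)) [ν.IsHaarMeasure] {𝓕 : Set ↥(adelicUnipotent (↥(maximalRealSubfield L)) L (IsCMField.complexConj L) 3)}
    (h𝓕N : IsFundamentalDomain ↥(rationalUnipotent (↥(maximalRealSubfield L)) L (IsCMField.complexConj L) 3) 𝓕 ν) (h𝓕c : IsCompact (closure 𝓕))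
    (K' : Subgroup (quasiSplit (↥(maximalRealSubfield L)) L (IsCMField.complexConj L) 3).Adelic) (ω : ↥K' →* ℂ)
    (χ₁ : ι → HeckeCharacter L) (χ₂ : ι → (↥(TorusDict.torus (IsCMField.complexConj L)) →ₜ* ℂˣ))
    (hu : ∀ b, (χ₁ b).IsUnitary) (hray : ∀ b (r : ℝ≥0ˣ), χ₁ b (posRealIdele L r) = 1) (hχ₂ : ∀ b, TorusDict.IsAutomorphic (IsCMField.complexConj L) (χ₂ b))
    (hχb : ∀ b (φ : (quasiSplit (↥(maximalRealSubfield L)) L (IsCMField.complexConj L) 3).Adelic → ℂ), φ ∈ chiSectionSpacePair (χ₁ b) (χ₂ b) K' (ω : ↥K' → ℂ) → Continuous φ → ∃ M : ℝ, ∀ g, ‖φ g‖ ≤ M) :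
    ∀ b b' : ι, b ≠ b' →
      ¬ ((χ₁ b' = χ₁ b ∧ χ₂ b' = χ₂ b) ∨ (χ₁ b' = reflectChar (IsCMField.complexConj L) (χ₁ b) ∧ χ₂ b' = χ₂ b)) →
      resGBlock L μ K' ω (χ₁ b) (χ₂ b) ⟂ resGBlock L μ K' ω (χ₁ b') (χ₂ b') :=
  hBO_of_pairXF L μ K' ω χ₁ χ₂ (hXF_of_rayTrivial_cm_three L μ νG μK νI h𝓕I ν h𝓕N h𝓕c K' ω χ₁ χ₂ hu hray hχ₂ hχb)

end Summit.HodgeConjecture.HodgeConjecture.Cruxes.H413.K2E1ChiPseudoEisensteinInnerProductCMThree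

end
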